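import Literature.Barriers.BirchSwinnertonDyer.RankNotSumOfLocalInvariantsF4Descent
import Literature.NumberTheory.EllipticCurves.QuadraticTwistRank
import Literature.NumberTheory.EllipticCurves.QuadraticTwistPadicReduction
import HarnessLib

/-!
# `rk E(F₄)` for `E = 480a1`, III: reduction to the four quadratic twists over `ℚ(√-1)`

Dokchitser–Dokchitser, *A note on the Mordell–Weil rank modulo `n`* (J. Number Theory 131
(2011); arXiv:0910.4588), proof of Thm. 2: "2-descent shows that […] `rk E/F₄ = 6` (e.g. using
Magma, over all minimal non-trivial subfields of `F_n`)", for `E = 480a1 : y² = x(x+2)(x-3)` and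
`F₄ = ℚ(√-1, √41, √73)`. The tree vendors this computation as the named fact
`Literature.Barriers.BirchSwinnertonDyer.DokchitserDokchitser2011_descent_480a1_F4`
(`(curve480a1.baseChange F4).mordellWeilRank = 6` for the concrete tower model
`F4 = K2(√73)`, `K2 = K1(√41)`, `K1 = ℚ(√-1)` of `RankNotSumOfLocalInvariantsF4Field.lean`).

This file PROVES the first step of that descent — the passage to a minimal non-trivial subfield,
here `K1 = ℚ(√-1)`: by the rank formula for quadratic extensions
`rank_ℤ E(L(√c)) = rank_ℤ E(L) + rank_ℤ E^{(c)}(L)` (tree theorem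
`WeierstrassCurve.lift_rank_point_baseChange_quadratic`, Silverman AEC Exercise 10.16, proved in
`Literature/NumberTheory/EllipticCurves/QuadraticTwistRank.lean`) applied along
`F4 / K2 / K1`,

`rank_ℤ E(F4) = rank_ℤ E(K1) + rank_ℤ E^{(41)}(K1) + rank_ℤ E^{(73)}(K1) + rank_ℤ E^{(2993)}(K1)`

(`rank_point_F4_eq`; `E^{(a)} = curve480a1.quadraticTwist a : y² = x³ - a x² - 6a² x`,
`2993 = 41 · 73`, twisting being multiplicative on these models,
`WeierstrassCurve.quadraticTwist_quadraticTwist`). Consequently the named fact follows from the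
four rank computations over `ℚ(√-1)` (`descent_480a1_F4_of_rank_K1`):
`rank_ℤ E(K1) = rank_ℤ E^{(41)}(K1) = rank_ℤ E^{(73)}(K1) = 1` and `rank_ℤ E^{(2993)}(K1) = 3`.
These four are genuine `2`-descents over `ℚ(√-1)` (the `2`-Selmer groups of the four curves over
`ℚ(√-1)` have `𝔽₂`-dimensions `3, 3, 3, 5`, sharp; by contrast over `ℚ` the `2`-Selmer groups of
the twists by `41`, `73`, `2993` are not sharp), carried out in the sequel files; here they are
hypotheses, stated as equalities of cardinals `Module.rank ℤ`.

Design notes.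
* All point groups carry Mathlib's `AddCommGroup` structure elaborated against the CLASSICAL
  `DecidableEq` instance, as in `WeierstrassCurve.mordellWeilRank` (`MordellWeil.lean`): the
  derived `DecidableEq` instance of `QuadraticAlgebra` is disabled in this file
  (`attribute [-instance] instDecidableEqQuadraticAlgebra`), so that
  `(curve480a1.baseChange F4).mordellWeilRank` unfolds to the `finrank` of the point group as
  written here (`rfl`).
* `rank_point_baseChange_quadraticAlgebra` is the tree's rank formula specialised to a
  `QuadraticAlgebra L c 0` step (`θ = ω`, `ω² = c`, `[L(ω) : L] = 2`), in `Type` (no universe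
  lifts); twisting commutes with base change by the tree's `WeierstrassCurve.map_quadraticTwist`.

## References

* T. Dokchitser, V. Dokchitser, *A note on the Mordell–Weil rank modulo `n`*, J. Number Theory
  131 (2011) 1833–1839, arXiv:0910.4588, proof of Thm. 2. [DokchitserDokchitser2011RankModN]
* J. H. Silverman, *The Arithmetic of Elliptic Curves*, 2nd ed., GTM 106 (2009), Exercise 10.16.
  [SilvermanAEC2009]
-/

noncomputable section

attribute [-instance] instDecidableEqQuadraticAlgebra

open scoped Classical

open QuadraticAlgebra

namespace WeierstrassCurve

/-- **Rank over a `QuadraticAlgebra` step.** For a field `L` with `2 ≠ 0`, `c ∈ L` not a square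
(so that `L(ω) = QuadraticAlgebra L c 0`, `ω² = c`, is a field, quadratic over `L`), and any
Weierstrass curve `W/L`: `rank_ℤ W(L(ω)) = rank_ℤ W(L) + rank_ℤ W^{(c)}(L)` — the tree theorem
`lift_rank_point_baseChange_quadratic` (Silverman AEC Exercise 10.16) with `θ = ω`.
[cite: SilvermanAEC2009, Exercise 10.16] -/
theorem rank_point_baseChange_quadraticAlgebra {L : Type} [Field L] [NeZero (2 : L)] (c : L)
    [Fact (∀ r : L, r ^ (2 : ℕ) ≠ c + 0 * r)] (W : WeierstrassCurve L) :
    Module.rank ℤ (W.baseChange (QuadraticAlgebra L c 0)).toAffine.Point =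
      Module.rank ℤ W.toAffine.Point + Module.rank ℤ (W.quadraticTwist c).toAffine.Point := by
  have hθ : (ω : QuadraticAlgebra L c 0) ∉ Set.range (algebraMap L (QuadraticAlgebra L c 0)) := by
    rintro ⟨r, hr⟩
    have h := congrArg QuadraticAlgebra.im hr
    simp at h
  have hc : (ω : QuadraticAlgebra L c 0) ^ 2 = algebraMap L (QuadraticAlgebra L c 0) c := by
    rw [sq, omega_mul_omega_eq_mk]
    ext <;> simp
  have h := lift_rank_point_baseChange_quadratic W (QuadraticAlgebra.finrank_eq_two c 0) hθ hc
  simpa only [Cardinal.lift_id] using h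

end WeierstrassCurve

namespace Literature.Barriers.BirchSwinnertonDyer

namespace DokchitserDokchitser2011

open WeierstrassCurve

/-- Base change along the tower: `(E ⊗ K1) ⊗ K2 = E ⊗ K2` for any `E/ℚ`. [folklore] -/
theorem baseChange_K1_K2 (W : WeierstrassCurve ℚ) :
    (W.baseChange K1).baseChange K2 = W.baseChange K2 :=
  map_baseChange (W := W) (Algebra.ofId K1 K2)

/-- Base change along the tower: `(E ⊗ K2) ⊗ F4 = E ⊗ F4` for any `E/ℚ`. [folklore] -/
theorem baseChange_K2_F4 (W : WeierstrassCurve ℚ) :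
    (W.baseChange K2).baseChange F4 = W.baseChange F4 :=
  map_baseChange (W := W) (Algebra.ofId K2 F4)

/-- Twisting an `E/ℚ` by a numeral `n` commutes with base change to `K1`. [folklore] -/
theorem quadraticTwist_baseChange_K1 (W : WeierstrassCurve ℚ) (n : ℕ) [n.AtLeastTwo] :
    (W.baseChange K1).quadraticTwist (OfNat.ofNat n : K1) =
      (W.quadraticTwist (OfNat.ofNat n : ℚ)).baseChange K1 := by
  rw [baseChange, baseChange, map_quadraticTwist, map_ofNat]

/-- Twisting an `E/ℚ` by a numeral `n` commutes with base change to `K2`. [folklore] -/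
theorem quadraticTwist_baseChange_K2 (W : WeierstrassCurve ℚ) (n : ℕ) [n.AtLeastTwo] :
    (W.baseChange K2).quadraticTwist (OfNat.ofNat n : K2) =
      (W.quadraticTwist (OfNat.ofNat n : ℚ)).baseChange K2 := by
  rw [baseChange, baseChange, map_quadraticTwist, map_ofNat]

/-- **One step down, `K2 → K1`**: for every `E/ℚ`,
`rank_ℤ E(K2) = rank_ℤ E(K1) + rank_ℤ E^{(41)}(K1)` (`K2 = K1(√41)`).
[cite: SilvermanAEC2009, Exercise 10.16] -/
theorem rank_point_K2_eq (W : WeierstrassCurve ℚ) :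
    Module.rank ℤ (W.baseChange K2).toAffine.Point =
      Module.rank ℤ (W.baseChange K1).toAffine.Point +
        Module.rank ℤ ((W.quadraticTwist 41).baseChange K1).toAffine.Point := by
  rw [← baseChange_K1_K2, rank_point_baseChange_quadraticAlgebra (41 : K1) (W.baseChange K1),
    quadraticTwist_baseChange_K1]

/-- **The top step, `F4 → K2`**: for every `E/ℚ`,
`rank_ℤ E(F4) = rank_ℤ E(K2) + rank_ℤ E^{(73)}(K2)` (`F4 = K2(√73)`).
[cite: SilvermanAEC2009, Exercise 10.16] -/
theorem rank_point_F4_eq_K2 (W : WeierstrassCurve ℚ) :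
    Module.rank ℤ (W.baseChange F4).toAffine.Point =
      Module.rank ℤ (W.baseChange K2).toAffine.Point +
        Module.rank ℤ ((W.quadraticTwist 73).baseChange K2).toAffine.Point := by
  rw [← baseChange_K2_F4, rank_point_baseChange_quadraticAlgebra (73 : K2) (W.baseChange K2),
    quadraticTwist_baseChange_K2]

/-- **`rk E(F₄)` is the sum of the ranks of the four twists over `ℚ(√-1)`**: for `E = 480a1`,
`rank_ℤ E(F4) = rank_ℤ E(K1) + rank_ℤ E^{(41)}(K1) + rank_ℤ E^{(73)}(K1) + rank_ℤ E^{(2993)}(K1)`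
(cardinal ranks of the point groups; `E^{(a)} = curve480a1.quadraticTwist a`,
`(E^{(73)})^{(41)} = E^{(2993)}`). This is "2-descent […] over all minimal non-trivial subfields
of `F₄`" reduced to the single minimal subfield `ℚ(√-1)`, by Silverman AEC Exercise 10.16 along
`F4 = K2(√73)`, `K2 = K1(√41)`. [cite: DokchitserDokchitser2011RankModN, proof of Thm. 2] -/
theorem rank_point_F4_eq :
    Module.rank ℤ (curve480a1.baseChange F4).toAffine.Point =
      Module.rank ℤ (curve480a1.baseChange K1).toAffine.Point +
        Module.rank ℤ ((curve480a1.quadraticTwist 41).baseChange K1).toAffine.Point +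
        Module.rank ℤ ((curve480a1.quadraticTwist 73).baseChange K1).toAffine.Point +
        Module.rank ℤ ((curve480a1.quadraticTwist 2993).baseChange K1).toAffine.Point := by
  rw [rank_point_F4_eq_K2, rank_point_K2_eq, rank_point_K2_eq, quadraticTwist_quadraticTwist,
    show (73 : ℚ) * 41 = 2993 by norm_num]
  simp only [add_assoc]

end DokchitserDokchitser2011

open DokchitserDokchitser2011 WeierstrassCurve

/-- **The descent leaf from the four twists over `ℚ(√-1)`.** If
`rank_ℤ E(ℚ(√-1)) = rank_ℤ E^{(41)}(ℚ(√-1)) = rank_ℤ E^{(73)}(ℚ(√-1)) = 1` and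
`rank_ℤ E^{(2993)}(ℚ(√-1)) = 3` for `E = 480a1` (cardinal ranks of the point groups over the
model `K1` of `ℚ(√-1)`), then `rk_ℤ E(F₄) = 6`, i.e. the named fact
`DokchitserDokchitser2011_descent_480a1_F4` holds (`rank_point_F4_eq` and `1 + 1 + 1 + 3 = 6`;
`mordellWeilRank = finrank = toNat ∘ rank`).
[cite: DokchitserDokchitser2011RankModN, proof of Thm. 2] -/
theorem descent_480a1_F4_of_rank_K1
    (h₁ : Module.rank ℤ (curve480a1.baseChange K1).toAffine.Point = 1)
    (h₄₁ : Module.rank ℤ ((curve480a1.quadraticTwist 41).baseChange K1).toAffine.Point = 1)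
    (h₇₃ : Module.rank ℤ ((curve480a1.quadraticTwist 73).baseChange K1).toAffine.Point = 1)
    (h₂₉₉₃ : Module.rank ℤ ((curve480a1.quadraticTwist 2993).baseChange K1).toAffine.Point = 3) :
    DokchitserDokchitser2011_descent_480a1_F4 := by
  have h : Module.rank ℤ (curve480a1.baseChange F4).toAffine.Point = 6 := by
    rw [rank_point_F4_eq, h₁, h₄₁, h₇₃, h₂₉₉₃]
    norm_num
  show Module.finrank ℤ (curve480a1.baseChange F4).toAffine.Point = 6
  rw [Module.finrank, h]
  norm_num

end Literature.Barriers.BirchSwinnertonDyer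

end
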